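import Summits.ValiantsHypothesis.ValiantsHypothesis.Theorems.AnyonJetsJetConstantElimPaddingHomogenisation
import Summits.ValiantsHypothesis.ValiantsHypothesis.Theorems.AnyonJetsConstantFreeJetGrowthDefs
import HarnessLib

/-!
# AnyonJets — crux `JetConstantElim` (stmt-ValiantsHypothesis-16737), stub `stub_integralMultiple`:
# the rational bounded-height slice (denominators are absorbed by the multiplier)

Line `Cruxes/JetConstantElim/Lines/birth.lean`, OPEN stub `stub_integralMultiple` (`IM`): for
`k ≤ log₂ n`, a fan-in-two `ℚ̄`-circuit `Q` for the jet `J_(n,k)` yields an integer fan-in-two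
circuit `P` of height `2^t` computing some `M · J_(n,k)`, `M ≥ 1`, with
`size P + t + 2 ≤ (size Q + n + 2)^{b₁}`. Its content splits as (i) irrationality (degree of the
field of definition), (ii) denominators, (iii) height. This file closes (ii) unconditionally, for
EVERY integer polynomial (not only the jets): by `constantFreeComplexity_multiple_le_of_rat_circuit`
(padding homogenisation of Bürgisser's integer skeleton, `…PaddingHomogenisation.lean`),

* `exists_integralMultiple_of_rat_circuit` — a fan-in-two circuit `Q` over `ℚ` computing
  `f ∈ ℤ[x]` whose constants have a common denominator `N ≤ 2^h` with numerators `|N c| ≤ 2^h`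
  yields a SIGN-CONSTANT (height `2^0`) integer circuit `P` for `N^(2^(3 size Q)) · f` with
  `size P + 0 + 2 ≤ (size Q + h + 2)^8`;
* `integralMultiple_ratSlice` — the same in the shape of the stub for `f = J_(n,k)` (the tree's
  `jet`, rfl-equal to the route's `let J`; all `n, k`):
  **`IM` holds on the slice "`Q` defined over `ℚ` with constants of height `≤ 2^h`" with
  `b₁ = 8` in the variable `size Q + h`** (the base change `Q.map (algebraMap ℚ ℚ̄)` is the
  `ℚ̄`-circuit of the stub, of the same size).

What remains of `IM` after this file and `integralMultiple_fixedOrder` (every fixed `k`) is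
exactly the height normal form: near-optimal `ℚ̄`-circuits of the jets definable over a number
field of polynomial DEGREE with constants of polynomial HEIGHT (restriction of scalars then
reduces to the present slice) — conjecture-grade, no technique in print
(`Cruxes/JetConstantElim/INTEGRAL-MULTIPLE-CENSUS.md`). Honest framing: the crux stays open;
VP ≠ VNP is NOT proved here.
-/

noncomputable section

-- single-conjunct layout: Sub = Summit, duplicated namespace component intended
set_option linter.dupNamespace false

namespace Summit.ValiantsHypothesis.ValiantsHypothesis.Theorems.AnyonJets.JetConstantElim

open MvPolynomial Literature.Computability.AlgebraicComplexity
open Literature.Computability.AlgebraicComplexity.ArithCircuit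
open Summit.ValiantsHypothesis.ValiantsHypothesis.Theorems.AnyonJets.ConstantFreeJetGrowth (jet)

/-- Envelope arithmetic: `2 (3s+2)² + (4s+1)(3(h+1)+1) + (3(h+1)+1) + 2 ≤ (s + h + 2)^8`. [folklore] -/
theorem denominators_envelope_le (s h : ℕ) :
    2 * (3 * s + 2) ^ 2 + (4 * s + 1) * (3 * (h + 1) + 1) + (3 * (h + 1) + 1) + 2 ≤
      (s + h + 2) ^ 8 := by
  set X := s + h + 2 with hX
  have hX2 : 2 ≤ X := by omega
  have h1 : 2 * (3 * s + 2) ^ 2 ≤ 18 * X ^ 2 := by nlinarith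
  have h2 : (4 * s + 1) * (3 * (h + 1) + 1) + (3 * (h + 1) + 1) ≤ 16 * X ^ 2 := by nlinarith
  have h3 : 18 * X ^ 2 + 16 * X ^ 2 + 2 ≤ 35 * X ^ 2 := by nlinarith
  have h4 : 35 * X ^ 2 ≤ X ^ 8 := by
    have h64 : 64 ≤ X ^ 6 := by
      calc (64 : ℕ) = 2 ^ 6 := by norm_num
        _ ≤ X ^ 6 := Nat.pow_le_pow_left hX2 6
    calc 35 * X ^ 2 ≤ X ^ 6 * X ^ 2 := Nat.mul_le_mul_right _ (by omega)
      _ = X ^ 8 := by ring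
  omega

/-- **Denominators are free (general integer polynomial).** A fan-in-two `ℚ`-circuit `Q` for
`f ∈ ℤ[x]` whose skeleton constants `slotConst Q v` have a common denominator `N`,
`1 ≤ N ≤ 2^h`, with numerators `|N · slotConst Q v| ≤ 2^h`, yields a sign-constant integer
fan-in-two circuit `P` computing `M · f`, `M = N^(2^(3 size Q)) ≥ 1`, satisfying the height
predicate of the line with `t = 0` and `size P + 0 + 2 ≤ (size Q + h + 2)^8`.
[folklore; Bürgisser 2000 §4.1, Strassen 1973] -/
theorem exists_integralMultiple_of_rat_circuit {σ : Type*} (f : MvPolynomial σ ℤ)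
    (Q : ArithCircuit ℚ σ) (h2 : Q.IsFanInTwo)
    (hc : Q.Computes (MvPolynomial.map (Int.castRingHom ℚ) f)) (N h : ℕ) (hN1 : 1 ≤ N)
    (hNh : N ≤ 2 ^ h) (p : Fin (4 * Q.size + 1) → ℤ)
    (hp : ∀ v : Fin (4 * Q.size + 1), (N : ℚ) * slotConst Q v = p v)
    (hph : ∀ v : Fin (4 * Q.size + 1), (p v).natAbs ≤ 2 ^ h) :
    ∃ (P : ArithCircuit ℤ σ) (t M : ℕ),
      1 ≤ M ∧ P.IsFanInTwo ∧ P.Computes ((M : ℤ) • f) ∧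
      ((∀ g ∈ P.gates, ∀ u ∈ g.args, ∀ c : ℤ, u = .const c → c.natAbs ≤ 2 ^ t) ∧
        (∀ args : List (ℤ × Operand ℤ σ), Gate.sum args ∈ P.gates →
          ∀ a ∈ args, a.1.natAbs ≤ 2 ^ t) ∧
        (∀ c : ℤ, P.output = .const c → c.natAbs ≤ 2 ^ t)) ∧
      P.size + t + 2 ≤ (Q.size + h + 2) ^ 8 := by
  have hτ := constantFreeComplexity_multiple_le_of_rat_circuit f Q h2 hc N p hp
  obtain ⟨P, hP2, hPs, hPc, hPsize⟩ :=
    exists_computes_size_eq_constantFreeComplexity (((N : ℤ) ^ 2 ^ (3 * Q.size)) • f)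
  -- a sign-constant circuit satisfies the height predicate with `t = 0`
  have hsc : ∀ c : ℤ, IsSignConstant c → c.natAbs ≤ 2 ^ 0 := by
    rintro c (h | h | h)
    · subst h; simp
    · subst h; simp
    · obtain rfl : c = -1 := by omega
      simp
  have hheight : (∀ g ∈ P.gates, ∀ u ∈ g.args, ∀ c : ℤ, u = .const c → c.natAbs ≤ 2 ^ 0) ∧
      (∀ args : List (ℤ × Operand ℤ σ), Gate.sum args ∈ P.gates →
        ∀ a ∈ args, a.1.natAbs ≤ 2 ^ 0) ∧
      (∀ c : ℤ, P.output = .const c → c.natAbs ≤ 2 ^ 0) := by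
    obtain ⟨hg, ho⟩ := hPs
    refine ⟨?_, fun args hargs a ha => hsc _ ((hg _ hargs) a ha).1, fun c hc => hsc _ (by
      rw [hc] at ho; exact ho)⟩
    intro g hgP u hu c huc
    subst huc
    have hgs := hg g hgP
    cases g with
    | sum args =>
      simp only [Gate.args, List.mem_map] at hu
      obtain ⟨a, ha, hau⟩ := hu
      have h2 := (hgs a ha).2
      rw [hau] at h2
      exact hsc _ h2
    | prod args => exact hsc _ (hgs _ hu)
  refine ⟨P, 0, N ^ 2 ^ (3 * Q.size), Nat.one_le_pow _ _ hN1, hP2, ?_, hheight, ?_⟩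
  · simpa [Nat.cast_pow] using hPc
  · have hsum : ∑ v : Fin (4 * Q.size + 1), constantFreeComplexity (C (p v) : MvPolynomial σ ℤ) ≤
        (4 * Q.size + 1) * (3 * (h + 1) + 1) :=
      calc ∑ v : Fin (4 * Q.size + 1), constantFreeComplexity (C (p v) : MvPolynomial σ ℤ)
          ≤ ∑ _v : Fin (4 * Q.size + 1), (3 * (h + 1) + 1) :=
            Finset.sum_le_sum fun v _ => constantFreeComplexity_C_le_of_natAbs_le (hph v)
        _ = (4 * Q.size + 1) * (3 * (h + 1) + 1) := by simp
    have hN : constantFreeComplexity (C (N : ℤ) : MvPolynomial σ ℤ) ≤ 3 * (h + 1) + 1 :=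
      constantFreeComplexity_C_le_of_natAbs_le (by simpa using hNh)
    have := denominators_envelope_le Q.size h
    omega

/-- **`IM` on the rational bounded-height slice** (all `n`, all `k`; `b₁ = 8` in `size Q + h`):
a fan-in-two circuit over `ℚ` for the jet `J_(n,k)` with constants of common denominator
`N ≤ 2^h` and numerators `≤ 2^h` yields `P`, `t = 0`, `M = N^(2^(3 size Q)) ≥ 1` as the stub
`stub_integralMultiple` asks, with `size P + t + 2 ≤ (size Q + h + 2)^8`. (Its base change
`Q.map (algebraMap ℚ ℚ̄)` is a `ℚ̄`-circuit of the stub of the same size; what the stub asks beyond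
this slice is the height normal form of the field of definition.) [folklore] -/
theorem integralMultiple_ratSlice (n k : ℕ) (Q : ArithCircuit ℚ (Fin n × Fin n))
    (h2 : Q.IsFanInTwo) (hc : Q.Computes (MvPolynomial.map (Int.castRingHom ℚ) (jet n k)))
    (N h : ℕ) (hN1 : 1 ≤ N) (hNh : N ≤ 2 ^ h) (p : Fin (4 * Q.size + 1) → ℤ)
    (hp : ∀ v : Fin (4 * Q.size + 1), (N : ℚ) * slotConst Q v = p v)
    (hph : ∀ v : Fin (4 * Q.size + 1), (p v).natAbs ≤ 2 ^ h) :
    ∃ (P : ArithCircuit ℤ (Fin n × Fin n)) (t M : ℕ),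
      1 ≤ M ∧ P.IsFanInTwo ∧ P.Computes ((M : ℤ) • jet n k) ∧
      ((∀ g ∈ P.gates, ∀ u ∈ g.args, ∀ c : ℤ, u = .const c → c.natAbs ≤ 2 ^ t) ∧
        (∀ args : List (ℤ × Operand ℤ (Fin n × Fin n)), Gate.sum args ∈ P.gates →
          ∀ a ∈ args, a.1.natAbs ≤ 2 ^ t) ∧
        (∀ c : ℤ, P.output = .const c → c.natAbs ≤ 2 ^ t)) ∧
      P.size + t + 2 ≤ (Q.size + h + 2) ^ 8 :=
  exists_integralMultiple_of_rat_circuit (jet n k) Q h2 hc N h hN1 hNh p hp hph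

end Summit.ValiantsHypothesis.ValiantsHypothesis.Theorems.AnyonJets.JetConstantElim

end
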